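import Summits.ResolutionOfSingularities.ResolutionOfSingularities.Theorems.EquisingularLiftEquisingularLiftNatMultisection
import Literature.AlgebraicGeometry.Resolution.StalkIdealLemmas
import Literature.AlgebraicGeometry.Resolution.PermissibleCentres
import HarnessLib

/-!
# [OURS · L1 W4.5(b) · EL♮] T-MULTISEC, the TRACE clause: the multisection through `b` cuts the running surface in the
# reduced point (crux `EquisingularLiftNat` = stmt-ResolutionOfSingularities-20038)

HONEST FRAMING. OURS (cell res-hironaka, crux chain w45b, slot W4.5(b)); NOT a statement of any manuscript; AI-written,
weaker than expert review. Helper `--supports stmt-ResolutionOfSingularities-20038 --as helper`; sequel of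
`…NatMultisection.lean` (p509091, `multisection_of_prime`). Consumer shape: res-D-pv-013's (MS) binder (STATUS
2026-08-27T07:06:22Z, T-TAIL / T-Δ-ISO) — «`∃ C`, `IsRegular C.subscheme` ∧ `Flat (C.subschemeι ≫ σ′ ≫ q)` ∧
`supp C ∩ (σ′ ≫ q)⁻¹{s₀} = {ι z}` ∧ `C.comap (vanishingIdeal ⟨closure S′,_⟩).subschemeι = vanishingIdeal ⟨{z}, _⟩`».

* `comap_primeDivisorIdeal_fromSpecStalk_eq` — **TRACE**: in the setting of `multisection_of_prime` (complete DVR `O`,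
  `r : P → Spec O` proper, `b` a `k`-rational special point, `𝔭 ⊂ 𝒪_{P,b}` with DVR quotient and `𝔪_O ↦ ≠ 0`), let
  `T ⊆ r⁻¹{s₀}` be closed (the running special-fibre surface) and `z` the point of `V(T)_red` over `b`; if
  `𝔭 + (I_T)_b = 𝔪_b` (the ring brick's `𝔭 + (u) = 𝔪_b` for some `u ∈ (I_T)_b ∖ 𝔪_b²`), then the pull-back of the
  multisection ideal `C = 𝓘_{closure {c}}` to `V(T)_red` IS the ideal sheaf of the reduced point `z`:
  `C.comap ι_T = vanishingIdeal ⟨{z}, _⟩` (stalks: at `z` both are `𝔪_{V(T),z}` because `(I_T)_b = ker (𝒪_{P,b} → 𝒪_{V(T),z})`;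
  elsewhere both are `⊤` because `supp C = {c, b}` and `c` is not a special point; ideal sheaves are compared stalkwise,
  `le_of_forall_stalkIdeal_le`).
* `exists_multisection_of_prime` — the (MS)-SHAPED PACKAGE given the ring brick's prime: `∃ C : P.IdealSheafData`,
  `Scheme.IsRegular C.subscheme ∧ Flat (C.subschemeι ≫ r) ∧ supp C ∩ r⁻¹{s₀} = {ι_T z} ∧ C.comap ι_T = vanishingIdeal ⟨{z},_⟩`.

The ring brick (a prime `𝔭` of the regular local ring `𝒪_{P,b}` with DVR quotient, `ϖ ∉ 𝔭`, `𝔭 + (u) = 𝔪_b`) is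
res-type-097's `Literature.RingTheory.RegularLocalRing.exists_isPrime_isDiscreteValuationRing_quotient_not_mem` (named
2026-08-27T06:59:44Z); the unconditional `∃ C` follows by one `obtain` once it lands.

References: Matsumura Thm. 8.4 [Matsumura1987]; Stacks 01W6, 01J7 [StacksProject]; Hartshorne III Prop. 9.7 [Hartshorne1977] —
through the cited tree files. OURS planning texts (index only): res-L1-w45b-lead-2 MEMO-2 v1.3 §7; res-D-pv-013 SIGNATURE T-Δ-ISO.
-/

set_option linter.dupNamespace false -- mandated namespace `Summit.<Summit>.<Problem>` of this single-conjunct summit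

open CategoryTheory AlgebraicGeometry TopologicalSpace Topology IsLocalRing
open AlgebraicGeometry.Scheme.IdealSheafData Literature.AlgebraicGeometry.Resolution

namespace Summit.ResolutionOfSingularities.ResolutionOfSingularities.Cruxes.EquisingularLiftNat.Sections

/-- **[OURS · L1 W4.5(b)] T-MULTISEC — THE TRACE CLAUSE.** Setting of `multisection_of_prime`: `O` a complete DVR,
`r : P → Spec O` proper, `b` a `k`-rational point of the special fibre, `𝔭 ⊂ 𝒪_{P,b}` a prime with DVR quotient in which
`𝔪_O` does not die, `c` the generisation of `b` defined by `𝔭`, `C = 𝓘_{closure {c}}`. Let `T ⊆ r⁻¹{s₀}` be a closed subset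
(the running surface inside the special fibre) and `z` the point of the reduced subscheme `V(T)` over `b`, and assume the
TRACE CONDITION `𝔭 + (I_T)_b = 𝔪_b`. Then `C · 𝒪_{V(T)} = 𝓘_{{z}}`: the multisection meets the running surface
scheme-theoretically in the REDUCED point `z` (so blowing up `P` along `C` blows up `V(T)` at the point `z`).
NOT a statement of the manuscript. [cite: StacksProject, Tag 01J7] -/
theorem comap_primeDivisorIdeal_fromSpecStalk_eq {O : Type} [CommRing O] [IsDomain O] [IsDiscreteValuationRing O]
    [IsAdicComplete (maximalIdeal O) O] {P : Scheme.{0}} (r : P ⟶ Spec (.of O)) [IsProper r] {b : P}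
    (hb : r b = closedPoint O)
    (hres : Function.Surjective ((residue (P.presheaf.stalk b)).comp ((Scheme.ΓSpecIso (.of O)).inv ≫
      (Spec (.of O)).presheaf.germ ⊤ (r b) trivial ≫ r.stalkMap b).hom))
    (p : Ideal (P.presheaf.stalk b)) [hp : p.IsPrime] [IsDiscreteValuationRing (P.presheaf.stalk b ⧸ p)]
    (hne : ∃ a ∈ maximalIdeal O, Ideal.Quotient.mk p (((Scheme.ΓSpecIso (.of O)).inv ≫
      (Spec (.of O)).presheaf.germ ⊤ (r b) trivial ≫ r.stalkMap b).hom a) ≠ 0)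
    (T : Closeds P) (hT : (T : Set P) ⊆ r ⁻¹' {closedPoint O}) (z : ↥(vanishingIdeal T).subscheme)
    (hz : (vanishingIdeal T).subschemeι z = b) (hzc : IsClosed ({z} : Set ↥(vanishingIdeal T).subscheme))
    (htr : p ⊔ stalkIdeal (vanishingIdeal T) b = maximalIdeal (P.presheaf.stalk b)) :
    (primeDivisorIdeal (P.fromSpecStalk b ⟨p, hp⟩)).comap (vanishingIdeal T).subschemeι =
      vanishingIdeal (⟨{z}, hzc⟩ : Closeds ↥(vanishingIdeal T).subscheme) := by
  subst hz
  obtain ⟨hsupp, hcs, -, -, -, -, hpb⟩ := multisection_of_prime r hb hres p hne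
  set c := P.fromSpecStalk ((vanishingIdeal T).subschemeι z) ⟨p, hp⟩ with hc
  set j := (vanishingIdeal T).subschemeι with hj
  -- stalks at `z`: both are the maximal ideal
  have hkz : RingHom.ker (j.stalkMap z).hom = stalkIdeal (vanishingIdeal T) (j z) := by
    rw [← stalkIdeal_ker_eq_ker_stalkMap j z, hj, Scheme.IdealSheafData.ker_subschemeι]
  have hz1 : stalkIdeal ((primeDivisorIdeal c).comap j) z = maximalIdeal _ := by
    rw [stalkIdeal_comap_eq_map_stalkMap, hpb, ← IsLocalRing.map_maximalIdeal_of_surjective _ (j.stalkMap_surjective z),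
      ← htr, Ideal.map_sup, (Ideal.map_eq_bot_iff_le_ker _).mpr (le_of_eq hkz.symm), sup_bot_eq]
  have hz2 : stalkIdeal (vanishingIdeal (⟨{z}, hzc⟩ : Closeds ↥(vanishingIdeal T).subscheme)) z = maximalIdeal _ :=
    stalkIdeal_vanishingIdeal_singleton hzc
  -- stalks off `z`: both are `⊤`
  have hoff1 : ∀ w : ↥(vanishingIdeal T).subscheme, w ≠ z → stalkIdeal ((primeDivisorIdeal c).comap j) w = ⊤ := by
    intro w hw
    rw [stalkIdeal_comap_eq_map_stalkMap, stalkIdeal_eq_top_of_not_mem_support, Ideal.map_top]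
    intro hmem
    rw [← SetLike.mem_coe, hsupp] at hmem
    rcases hmem with h1 | h1
    · -- `j w = c` is impossible: `j w` lies in `T ⊆ r⁻¹{s₀}` but `r c ≠ s₀`
      apply hcs
      have hw0 : r (j w) = closedPoint O := hT (ComponentGluing.mem_of_subscheme_vanishingIdeal T w)
      rw [h1] at hw0
      exact hw0
    · exact hw (j.isClosedEmbedding.injective (Set.mem_singleton_iff.mp h1))
  have hoff2 : ∀ w : ↥(vanishingIdeal T).subscheme, w ≠ z →
      stalkIdeal (vanishingIdeal (⟨{z}, hzc⟩ : Closeds ↥(vanishingIdeal T).subscheme)) w = ⊤ := by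
    intro w hw
    apply stalkIdeal_eq_top_of_not_mem_support
    rw [← SetLike.mem_coe, Scheme.IdealSheafData.coe_support_vanishingIdeal]
    exact hw
  -- compare stalkwise
  apply le_antisymm
  · apply le_of_forall_stalkIdeal_le
    intro w
    by_cases hw : w = z
    · subst hw; rw [hz1, hz2]
    · rw [hoff1 w hw, hoff2 w hw]
  · apply le_of_forall_stalkIdeal_le
    intro w
    by_cases hw : w = z
    · subst hw; rw [hz1, hz2]
    · rw [hoff1 w hw, hoff2 w hw]

/-- **[OURS · L1 W4.5(b)] T-MULTISEC, (MS)-SHAPED PACKAGE (given the ring brick's prime).** `O` a complete DVR,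
`r : P → Spec O` proper, `T ⊆ r⁻¹{s₀}` closed, `z` a CLOSED point of `V(T)_red` with `b := ι_T z` a `k`-rational point;
given a prime `𝔭 ⊂ 𝒪_{P,b}` with DVR quotient, `𝔪_O ↦ ≠ 0` and the trace condition `𝔭 + (I_T)_b = 𝔪_b` (for `𝒪_{P,b}`
regular of embedding dimension `d` and `emb dim_z V(T) ≤ d − 1` such a prime exists by the ring brick), there is an ideal
sheaf `C` on `P` with `V(C)` REGULAR, `V(C) ↪ P → Spec O` FLAT, `supp C ∩ r⁻¹{s₀} = {ι_T z}` and
`C · 𝒪_{V(T)} = 𝓘_{{z}}` — res-D-pv-013's (MS) conclusion verbatim. NOT a statement of the manuscript.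
[cite: Matsumura1987, Thm. 8.4; StacksProject, Tag 01W6] -/
theorem exists_multisection_of_prime {O : Type} [CommRing O] [IsDomain O] [IsDiscreteValuationRing O]
    [IsAdicComplete (maximalIdeal O) O] {P : Scheme.{0}} (r : P ⟶ Spec (.of O)) [IsProper r]
    (T : Closeds P) (hT : (T : Set P) ⊆ r ⁻¹' {closedPoint O}) (z : ↥(vanishingIdeal T).subscheme)
    (hzc : IsClosed ({z} : Set ↥(vanishingIdeal T).subscheme))
    (hres : Function.Surjective ((residue (P.presheaf.stalk ((vanishingIdeal T).subschemeι z))).comp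
      ((Scheme.ΓSpecIso (.of O)).inv ≫ (Spec (.of O)).presheaf.germ ⊤ (r ((vanishingIdeal T).subschemeι z)) trivial ≫
        r.stalkMap ((vanishingIdeal T).subschemeι z)).hom))
    (p : Ideal (P.presheaf.stalk ((vanishingIdeal T).subschemeι z))) [hp : p.IsPrime]
    [IsDiscreteValuationRing (P.presheaf.stalk ((vanishingIdeal T).subschemeι z) ⧸ p)]
    (hne : ∃ a ∈ maximalIdeal O, Ideal.Quotient.mk p (((Scheme.ΓSpecIso (.of O)).inv ≫
      (Spec (.of O)).presheaf.germ ⊤ (r ((vanishingIdeal T).subschemeι z)) trivial ≫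
        r.stalkMap ((vanishingIdeal T).subschemeι z)).hom a) ≠ 0)
    (htr : p ⊔ stalkIdeal (vanishingIdeal T) ((vanishingIdeal T).subschemeι z) =
      maximalIdeal (P.presheaf.stalk ((vanishingIdeal T).subschemeι z))) :
    ∃ C : P.IdealSheafData, Scheme.IsRegular C.subscheme ∧ Flat (CategoryStruct.comp C.subschemeι r) ∧
      (C.support : Set P) ∩ r ⁻¹' {closedPoint O} = {(vanishingIdeal T).subschemeι z} ∧
      C.comap (vanishingIdeal T).subschemeι = vanishingIdeal (⟨{z}, hzc⟩ : Closeds ↥(vanishingIdeal T).subscheme) := by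
  have hb : r ((vanishingIdeal T).subschemeι z) = closedPoint O :=
    hT (ComponentGluing.mem_of_subscheme_vanishingIdeal T z)
  obtain ⟨-, -, hsf, -, hreg, hflat, -⟩ := multisection_of_prime r hb hres p hne
  exact ⟨_, hreg, hflat, hsf, comap_primeDivisorIdeal_fromSpecStalk_eq r hb hres p hne T hT z rfl hzc htr⟩

end Summit.ResolutionOfSingularities.ResolutionOfSingularities.Cruxes.EquisingularLiftNat.Sections
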